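import Summits.QuantumFields.YangMills.Theorems.VirialFluxGapRingFrameHessian
import HarnessLib

/-!
# Route `VirialFluxGap` (YangMills): THE FRAME GRADIENT IS CONTROLLED BY THE ENERGY — `(∂_Y F₀(P))² ≤ 2·M·F₀(P)` for a bound `M` on the second
# frame derivative along `Y` (non-negativity of `F₀` + Taylor)

Generic brick for the central charts ∕ the assembly of ⟨stmt-QuantumFields-24141⟩ (LEAD design note №4 (b)–(c): the subtracted gradient
`∇F₀(x) − ∇F₀(π_C x)` and the error terms need the size of the frame gradient at the projected point `π_C x`, where `F₀ = O(L²|z|⁴)` by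
✓`ringDeficit_centralProj_le`; this file turns any energy bound into a gradient bound WITHOUT computing the cubic seam vertex explicitly):

* §1 ★ `deriv_sq_le_two_mul_of_nonneg` — for `f : ℝ → ℝ` twice differentiable, `f ≥ 0` everywhere and `|f''| ≤ M`: `f'(0)² ≤ 2·M·f(0)`
  (quadratic Taylor majorant `f(t) ≤ f(0) + f'(0)t + ½Mt²`, `le_quad_of_deriv2_le`, evaluated at `t = −f'(0)/M`);
* §2 ★★ `frameD_sq_le_two_mul_ringDeficit` — along the multi-direction curve of ✓`FrameHessian.multiCurve`:
  `(frameD Y ringPoly (ringCoord P))² ≤ 2·M·F₀(P)` whenever `|frameD Y (frameD Y ringPoly)| ≤ M` on the ring space; and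
  ★ `exists_frameD_sq_le_ringDeficit` — such an `M ≥ 0` exists for every skew-Hermitian traceless assignment `Y` (compactness; fcl-p3's explicit
  derivative bounds can be fed to the first form instead).

HONEST FRAMING: calculus; ⟨24141⟩ stays OPEN; the Yang–Mills mass gap is NOT proved; no summit is proved by a line.  THEOREMS ONLY (0 `def`,
0 `sorry`), standard axioms.  Width seat `ym-line-sfw-p2-w3` g58 (cell ym-idea-1, free hands), `--supports stmt-QuantumFields-24141`.
References: [folklore] (Glaeser-type inequality for non-negative `C²` functions); [cite: arXiv220412737, §2 (2.4) (p. 10)].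
-/

set_option autoImplicit false

noncomputable section

open scoped Matrix BigOperators ContDiff Topology
open Literature.MathematicalPhysics.QuantumFieldTheory hiding SU2
open Literature.MathematicalPhysics.QuantumLattice

namespace Summit.QuantumFields.YangMills.Theorems.VirialFluxGap.FrameDerivative

open Summit.QuantumFields.YangMills.Theorems.FemtoTransferGap
open Summit.QuantumFields.YangMills.Theorems.VirialFluxGap.RingDeficit
open Summit.QuantumFields.YangMills.Theorems.VirialFluxGap.FrameHessian

variable {L : ℕ} [NeZero L]

/-! ## §1 Non-negative functions with bounded second derivative -/

omit [NeZero L] in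
/-- Quadratic Taylor majorant on `t ≥ 0`: `f(t) ≤ f(0) + f'(0)·t + ½M·t²` when `f'' ≤ M`. [folklore] -/
theorem le_quad_of_deriv2_le_of_nonneg {f f' f'' : ℝ → ℝ} {M : ℝ} (hf : ∀ t, HasDerivAt f (f' t) t) (hf' : ∀ t, HasDerivAt f' (f'' t) t)
    (hM : ∀ t, f'' t ≤ M) {t : ℝ} (ht : 0 ≤ t) : f t ≤ f 0 + f' 0 * t + M / 2 * t ^ 2 := by
  -- `φ s = f' s − f' 0 − M s` is antitone, hence `≤ 0` for `s ≥ 0`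
  have hlin : ∀ (c : ℝ) (s : ℝ), HasDerivAt (fun s => c * s) c s := fun c s => by
    simpa using (hasDerivAt_id s).const_mul c
  have hφd : ∀ s, HasDerivAt (fun s => f' s - f' 0 - M * s) (f'' s - M) s := fun s =>
    ((hf' s).sub_const (f' 0)).fun_sub (hlin M s)
  have hφanti : Antitone (fun s => f' s - f' 0 - M * s) :=
    antitone_of_deriv_nonpos (fun s => (hφd s).differentiableAt) fun s => by
      rw [(hφd s).deriv]; linarith [hM s]
  have hφ : ∀ s, 0 ≤ s → f' s - f' 0 - M * s ≤ 0 := fun s hs => by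
    have h := hφanti hs
    simpa using h
  -- `ψ t = f t − f 0 − f' 0 t − ½Mt²` is antitone on `[0, ∞)`
  have hsq : ∀ s : ℝ, HasDerivAt (fun s => M / 2 * s ^ 2) (M * s) s := fun s => by
    have h := (hasDerivAt_pow 2 s).const_mul (M / 2)
    refine h.congr_deriv ?_
    norm_num; ring
  have hψd : ∀ s, HasDerivAt (fun s => f s - f 0 - f' 0 * s - M / 2 * s ^ 2) (f' s - f' 0 - M * s) s := fun s =>
    (((hf s).sub_const (f 0)).fun_sub (hlin (f' 0) s)).fun_sub (hsq s)
  have hψanti : AntitoneOn (fun s => f s - f 0 - f' 0 * s - M / 2 * s ^ 2) (Set.Ici 0) :=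
    antitoneOn_of_deriv_nonpos (convex_Ici 0) (fun s _ => (hψd s).continuousAt.continuousWithinAt)
      (fun s _ => (hψd s).differentiableAt.differentiableWithinAt) fun s hs => by
        rw [interior_Ici] at hs
        rw [(hψd s).deriv]
        exact hφ s (le_of_lt hs)
  have h := hψanti (Set.mem_Ici.2 le_rfl) (Set.mem_Ici.2 ht) ht
  simp at h
  linarith

omit [NeZero L] in
/-- Quadratic Taylor majorant on all of `ℝ`: `f(t) ≤ f(0) + f'(0)·t + ½M·t²` when `|f''| ≤ M`. [folklore] -/
theorem le_quad_of_deriv2_le {f f' f'' : ℝ → ℝ} {M : ℝ} (hf : ∀ t, HasDerivAt f (f' t) t) (hf' : ∀ t, HasDerivAt f' (f'' t) t)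
    (hM : ∀ t, |f'' t| ≤ M) (t : ℝ) : f t ≤ f 0 + f' 0 * t + M / 2 * t ^ 2 := by
  rcases le_or_gt 0 t with ht | ht
  · exact le_quad_of_deriv2_le_of_nonneg hf hf' (fun s => (le_abs_self _).trans (hM s)) ht
  · -- reflect: `g s = f (−s)`
    have hg : ∀ s, HasDerivAt (fun s => f (-s)) (-f' (-s)) s := fun s => by
      have h : HasDerivAt (fun s => f (-s)) (f' (-s) * -1) s := (hf (-s)).comp s (hasDerivAt_neg s)
      exact h.congr_deriv (by ring)
    have hg' : ∀ s, HasDerivAt (fun s => -f' (-s)) (f'' (-s)) s := fun s => by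
      have h : HasDerivAt (fun s => f' (-s)) (f'' (-s) * -1) s := (hf' (-s)).comp s (hasDerivAt_neg s)
      exact h.neg.congr_deriv (by ring)
    have h := le_quad_of_deriv2_le_of_nonneg hg hg' (fun s => (le_abs_self _).trans (hM (-s))) (t := -t) (by linarith)
    simp only [neg_neg, neg_zero] at h
    nlinarith [h]

omit [NeZero L] in
/-- ★ **Gradient controlled by the value for non-negative functions**: `f ≥ 0`, `|f''| ≤ M` ⇒ `f'(0)² ≤ 2·M·f(0)`. [folklore] -/
theorem deriv_sq_le_two_mul_of_nonneg {f f' f'' : ℝ → ℝ} {M : ℝ} (hf : ∀ t, HasDerivAt f (f' t) t) (hf' : ∀ t, HasDerivAt f' (f'' t) t)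
    (hM : ∀ t, |f'' t| ≤ M) (h0 : ∀ t, 0 ≤ f t) : (f' 0) ^ 2 ≤ 2 * M * f 0 := by
  have hq := le_quad_of_deriv2_le hf hf' hM
  have hM0 : 0 ≤ M := (abs_nonneg _).trans (hM 0)
  rcases hM0.eq_or_lt with hM0 | hMpos
  · -- `M = 0`: the linear majorant of a non-negative function forces `f'(0) = 0`
    subst hM0
    suffices h : f' 0 = 0 by rw [h]; simp
    by_contra hne
    have h1 := hq (-(f 0 + 1) / f' 0)
    have h2 := h0 (-(f 0 + 1) / f' 0)
    have e : f' 0 * (-(f 0 + 1) / f' 0) = -(f 0 + 1) := by field_simp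
    rw [e] at h1
    linarith
  · have h1 := hq (-(f' 0) / M)
    have h2 := h0 (-(f' 0) / M)
    have e : f 0 + f' 0 * (-(f' 0) / M) + M / 2 * (-(f' 0) / M) ^ 2 = f 0 - (f' 0) ^ 2 / (2 * M) := by
      field_simp; ring
    rw [e] at h1
    have h3 : (f' 0) ^ 2 / (2 * M) ≤ f 0 := by linarith
    rw [div_le_iff₀ (by linarith)] at h3
    linarith

/-! ## §2 The frame gradient of the deficit -/

open scoped Matrix.Norms.Frobenius

attribute [local instance 2000] Literature.MathematicalPhysics.QuantumFieldTheory.SUNBakryEmery.matTop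

/-- ★★ **The frame gradient is controlled by the energy**: if the second frame derivative of `ringPoly` along `Y` is bounded by `M` on the ring
space, then `(∂_Y F₀(P))² ≤ 2·M·F₀(P)` at every `P` (`F₀ ≥ 0` along the one-parameter subgroup). [cite: arXiv220412737, §2 (2.4) (p. 10)] -/
theorem frameD_sq_le_two_mul_ringDeficit (Y : ((Fin (2 * L - 1 + 1) × Edge 3 L) ⊕ Site 3 L) → Matrix (Fin 2) (Fin 2) ℂ)
    (hY : ∀ w, (Y w)ᴴ = -Y w) (hY0 : ∀ w, (Y w).trace = 0) {M : ℝ}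
    (hM : ∀ Q : (Fin (2 * L - 1 + 1) → GaugeConfig 3 L SU2) × (Site 3 L → SU2), |frameD Y (frameD Y (ringPoly L)) (ringCoord L Q)| ≤ M)
    (P : (Fin (2 * L - 1 + 1) → GaugeConfig 3 L SU2) × (Site 3 L → SU2)) :
    (frameD Y (ringPoly L) (ringCoord L P)) ^ 2 ≤ 2 * M * ringDeficit L (fun _ => false) P := by
  have hf : ∀ t, HasDerivAt (fun s => ringDeficit L (fun _ => false) (P * multiCurve Y hY hY0 s))
      (frameD Y (ringPoly L) (ringCoord L (P * multiCurve Y hY hY0 t))) t := hasDerivAt_ringDeficit_multiCurve Y hY hY0 P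
  have hf' : ∀ t, HasDerivAt (fun s => frameD Y (ringPoly L) (ringCoord L (P * multiCurve Y hY hY0 s)))
      (frameD Y (frameD Y (ringPoly L)) (ringCoord L (P * multiCurve Y hY hY0 t))) t :=
    hasDerivAt_comp_multiCurve (contDiff_frameD (contDiff_ringPoly (L := L)) Y) Y hY hY0 P
  have h := deriv_sq_le_two_mul_of_nonneg hf hf' (fun t => hM _) (fun t => ringDeficit_nonneg _ _)
  simpa only [multiCurve_zero, mul_one] using h

/-- ★ **An energy–gradient constant exists for every direction** (compactness of the ring space): `∃ M ≥ 0, ∀ P, (∂_Y F₀(P))² ≤ 2·M·F₀(P)`.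
[folklore] -/
theorem exists_frameD_sq_le_ringDeficit (Y : ((Fin (2 * L - 1 + 1) × Edge 3 L) ⊕ Site 3 L) → Matrix (Fin 2) (Fin 2) ℂ)
    (hY : ∀ w, (Y w)ᴴ = -Y w) (hY0 : ∀ w, (Y w).trace = 0) :
    ∃ M : ℝ, 0 ≤ M ∧ ∀ P : (Fin (2 * L - 1 + 1) → GaugeConfig 3 L SU2) × (Site 3 L → SU2),
      (frameD Y (ringPoly L) (ringCoord L P)) ^ 2 ≤ 2 * M * ringDeficit L (fun _ => false) P := by
  have hc : Continuous (frameD Y (frameD Y (ringPoly L))) :=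
    (contDiff_frameD (contDiff_frameD (contDiff_ringPoly (L := L)) Y) Y).continuous
  obtain ⟨B, hB⟩ := (regular_comp_ringCoord (L := L) hc).2.1
  refine ⟨max B 0, le_max_right _ _, fun P => ?_⟩
  exact frameD_sq_le_two_mul_ringDeficit Y hY hY0 (fun Q => (hB Q).trans (le_max_left _ _)) P

end Summit.QuantumFields.YangMills.Theorems.VirialFluxGap.FrameDerivative

end
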